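import Summits.BirchSwinnertonDyer.Rank1Residual.Additive.GordEvenCongruentPairGV
import HarnessLib

/-!
# The μ-ANCHOR BRICK on the EQUAL-PARITY swap locus, part 2: `CongruentLambdaShift` and `μ` from the
# GV record, all per-curve binders from records, on Gord_e346 × Gord_e346 congruence links with BOTH
# members line-even — `e_i` even, `e_i ≠ 2`, `(p−1)/e_i` odd: the (5;4,4) and (7;6,6) links
# (cell `b2b-bsdres`, team n1011, seat p07 (gen 8); r2 §II.27 T2 of the ARM α e346 package
# T1/T2/T3, lead R5-71 (i); sequel of `GordEvenCongruentPairGV`)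

HONEST FRAMING (cell `b2b-bsdres`, run/shared/lean/b2b/bsd-rank1-residual/, verbatim in every
file): the goal of the cell is to DELETE the COMBINATION-SHAPED residual classes of the
Birch–Swinnerton-Dyer formula for ALL analytic-rank `≤ 1` elliptic curves over `ℚ` — "full BSD
formula for every rank `≤ 1` curve in class `C`" assembled STRICTLY from published theorems — so
that the rank-`≤ 1` remainder becomes exactly the CONSTRUCTION-SHAPED classes, which are TYPED
(missing-input `Prop`s), NOT attempted. This is not "finishing BSD". Team n1011 (N10/N11, the (G-ord)
rows of defect `e ∈ {4, 6}`): research route; labels and marks UNCHANGED; nothing booked. TOOL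
theorems only: NO definition, NO named fact; NOT budget nodes (r2 II.27.6). CONDITIONAL exactly as
the consumed files: §1–§2 carry the R-D identifications `hRD₁`, `hRD₂` (`RamifiedLineKummerEqAt`) as
EXPLICIT binders and the GV record `hGV` (A240 — `= …_of_records h23 h414`, p12 K4 FINAL) where the
λ-reading needs it; §3 discharges `hRD_i` mod cc-typer-2's S2 record
(`imKummer_ge_strictCondition_goodOrdinaryModel`, p05 K5 via `ramifiedLineKummerEqAt_of_s2_of_typeGOrd`).

## What and why

Row T-ROL-EXP (gen 7) typed the GV transfer on Gord × Gord links of any defects OFF the swap locus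
`(p−1) ∣ lcm(e₁, e₂)` (files C/D/D2/F: matching by cc-typer-2's S3 + exponents). ON the locus,
cc-typer-2's S4 (`exists_lines_matching_of_lineHalfPow`, p291619) matches the lines of two LINE-EVEN
curves, and row T-ROL-ORD's F4 lane (p16's `IsRamifiedOrdinaryLine.lineHalfPow_of_typeGOrd_of_even`,
`exists_lines_matching_of_typeGOrd_of_even`, `inclusion_mem_iff_of_typeGOrd_of_even`) proves
line-evenness on every (G-ord) row with `e` even, `e ≠ 2`, `(p−1)/e` odd — cc-typer-2's T6 receipt:
the (5;4,4) 297 + (7;6,6) 43 CONG links, every one an OPEN ↔ OPEN e346 pair; r2 II.27: the 6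
'ANCHORED-PENDING' Route-2 rows {131100f1, 133350bm1, 233450cr1, 423150da1, 46200dg1, 499800el1}.
This file is r2's **T2**: the same consumer layer as T-ROL-EXP D/D2/F with `hlines` from the F4 lane.

* (part 1, `GordEvenCongruentPairGV`) §0 `forall_exists_lines_matching_of_typeGOrd_of_even`; §1 (p12 MF `…_of_matching`): `natCard_torsionBy_nonPrimitiveSelmerInfty_eq_of_typeGOrd_typeGOrd_of_even`,
  `selmer_isTorsion_and_mu_eq_zero_…`, `nonPrimitive_lambdaInvariant_eq_…` (hRD₁ hRD₂ explicit).
* §2 (cc-typer-2's schema `congruentLambdaShift_of_gv` / `mu_eq_zero_of_gv`):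
  `congruentLambdaShift_of_gv_of_typeGOrd_typeGOrd_of_even`, `mu_eq_zero_of_gv_…` (hGV, hRD explicit).
* §3 all per-curve binders from records (hRD mod S2): `…_of_gv_of_s2_of_typeGOrd_typeGOrd_of_even` and
  the class forms `ClassX4Gord./ClassX3Gord.congruentLambdaShift_of_gv_of_s2_of_even`,
  `….mu_eq_zero_of_gv_of_s2_of_even`.

NOT here: T1 (cc-typer-2, `TameBranchUpperOfRatDvd`), T3 (`X(E₁/ℚ_∞) = 0` by control, p12/p04), any
budget / END (the e346 Kato-direction input is construction-shaped), MIXED-parity links (dead by S4b),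
`p = 3`, `e = 2`.

References: R. Greenberg, V. Vatsal, Invent. Math. 142 (2000) §2 Prop. (2.8), Remark (2.9), Cor. (2.3),
Prop. (2.4), pp. 26–27 [GreenbergVatsal2000]; R. Greenberg, LNM 1716 (1999) Prop. 2.4, Prop. 5.10
[GreenbergLNM1716]; M. Emerton, R. Pollack, T. Weston, Invent. Math. 163 (2006) pp. 2–3, §3.1
[EmertonPollackWeston2006]; cells/n1011/ROUTE-2.md §II.27 (T2); class-closure/N10/TRANSPORT-TEMPLATE.md v2.1.
-/

set_option autoImplicit false

noncomputable section

open scoped Classical NumberField AddSubgroup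

open NumberField IsDedekindDomain Field WeierstrassCurve
  Literature.NumberTheory.GaloisRepresentations Literature.NumberTheory.EllipticCurves
  Literature.NumberTheory.EllipticCurves.GreenbergSelmer
  Literature.NumberTheory.EllipticCurves.Greenberg1999
  Literature.NumberTheory.EllipticCurves.GreenbergVatsal2000
  Literature.NumberTheory.EllipticCurves.EmertonPollackWeston2006
  Literature.NumberTheory.EllipticCurves.Rank1Residual
  Summit.BirchSwinnertonDyer.Rank1Residual.X2.TorsionComparison
  Summit.BirchSwinnertonDyer.Rank1Residual.X2.GreenbergVatsalTorsion

namespace Summit.BirchSwinnertonDyer.Rank1Residual.Additive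

open Summit.BirchSwinnertonDyer.Rank1Residual.X1.CongruenceTransfer
open GordHigherCongruentPairGVShift GordHigherCongruentPairGVOfS2
open WeierstrassCurve (geomTorsion geomPrimaryTorsion geomTorsion_le_geomPrimaryTorsion)

namespace GordEvenCongruentPairGV

/-! ### §2 `CongruentLambdaShift` and `μ` from the GV record (cc-typer-2's schema) -/

section Shift

variable {p : ℕ} [hp : Fact p.Prime] {W₁ W₂ : WeierstrassCurve ℚ} [W₁.IsElliptic] [W₁.IsGloballyMinimal]
  [W₂.IsElliptic] [W₂.IsGloballyMinimal]

/-- **Route G's typed input `CongruentLambdaShift W₁ W₂ p (Σ_{w∈Σ₀}(δ(E₂,w) − δ(E₁,w)))` on a line-even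
Gord × Gord link, from the GV record `hGV` (A240 = `…_of_records h23 h414`) + `TorsionIso` + `Σ₀`**
(`p ≥ 5`; hRD₁, hRD₂ explicit). cc-typer-2's schema `congruentLambdaShift_of_gv` with
`hiso := ⟨e, he, inclusion_mem_iff_of_typeGOrd_of_even … e he'⟩` (the F4 lane's matching at the
`Γ_ℚ`-equivariant `e`, restricted to inertia).
[cite: GreenbergVatsal2000, §2 Prop. (2.8) with Remark (2.9), Cor. (2.3), Prop. (2.4), pp. 26–27 (arXiv:math/9906215)] -/
theorem congruentLambdaShift_of_gv_of_typeGOrd_typeGOrd_of_even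
    (hGV : muLambdaAlg_transfer_of_torsionIso_potOrd_of_not_dvd_torsionOrder) (hp5 : 5 ≤ p)
    (hG₁ : TypeGOrd W₁ p) (hadd₁ : Addv W₁ p) (h2e₁ : 2 ∣ semistabilityIndex W₁ p)
    (he2₁ : semistabilityIndex W₁ p ≠ 2) (hodd₁ : ¬ 2 ∣ (p - 1) / semistabilityIndex W₁ p)
    (hG₂ : TypeGOrd W₂ p) (hadd₂ : Addv W₂ p) (h2e₂ : 2 ∣ semistabilityIndex W₂ p)
    (he2₂ : semistabilityIndex W₂ p ≠ 2) (hodd₂ : ¬ 2 ∣ (p - 1) / semistabilityIndex W₂ p)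
    (htors₁ : ¬ p ∣ W₁.torsionOrder) (htors₂ : ¬ p ∣ W₂.torsionOrder)
    (hRD₁ : RamifiedLineKummerEqAt W₁ p) (hRD₂ : RamifiedLineKummerEqAt W₂ p) (hT : TorsionIso W₁ W₂ p)
    (S₀ : Finset (HeightOneSpectrum (𝓞 ℚ))) (hS₀ : ∀ w ∈ S₀, ((p : ℕ) : 𝓞 ℚ) ∉ w.asIdeal)
    (hS₁ : ∀ w : HeightOneSpectrum (𝓞 ℚ), w ∉ S₀ → ((p : ℕ) : 𝓞 ℚ) ∉ w.asIdeal →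
      W₁.HasGoodReductionAt w)
    (hS₂ : ∀ w : HeightOneSpectrum (𝓞 ℚ), w ∉ S₀ → ((p : ℕ) : 𝓞 ℚ) ∉ w.asIdeal →
      W₂.HasGoodReductionAt w) :
    CongruentLambdaShift W₁ W₂ p (∑ w ∈ S₀, ((delta W₂ p w : ℤ) - (delta W₁ p w : ℤ))) := by
  obtain ⟨v, hv⟩ := exists_natCast_mem_asIdeal (p := p)
  obtain ⟨L₁, hL₁, -⟩ := exists_isRamifiedOrdinaryLine_and_pow_semistabilityIndex_of_typeGOrd hp5 hG₁ hadd₁ hv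
  obtain ⟨L₂, hL₂, -⟩ := exists_isRamifiedOrdinaryLine_and_pow_semistabilityIndex_of_typeGOrd hp5 hG₂ hadd₂ hv
  obtain ⟨e, he⟩ := hT
  exact congruentLambdaShift_of_gv W₁ W₂ p S₀ hGV (by omega) hv hL₁ hL₂ htors₁ htors₂ hRD₁ hRD₂
    ⟨e, he, inclusion_mem_iff_of_typeGOrd_of_even hp5 hG₁ hadd₁ h2e₁ he2₁ hodd₁ hG₂ hadd₂ h2e₂ he2₂ hodd₂
      hv hL₁ hL₂ e (fun σ _ P ↦ he _ P)⟩ hS₀ hS₁ hS₂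

/-- **`μ(X(E₁)) = 0 ⟹ μ(X(E₂)) = 0` on a line-even Gord × Gord link, from the GV record + `TorsionIso`**
(cyclotomic data, torsion duals; hRD₁, hRD₂ explicit). cc-typer-2's schema `mu_eq_zero_of_gv`.
[cite: GreenbergVatsal2000, §2 Prop. (2.8) with Remark (2.9), Cor. (2.3), pp. 26–27 (arXiv:math/9906215)] -/
theorem mu_eq_zero_of_gv_of_typeGOrd_typeGOrd_of_even
    (hGV : muLambdaAlg_transfer_of_torsionIso_potOrd_of_not_dvd_torsionOrder) (hp5 : 5 ≤ p)
    (hG₁ : TypeGOrd W₁ p) (hadd₁ : Addv W₁ p) (h2e₁ : 2 ∣ semistabilityIndex W₁ p)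
    (he2₁ : semistabilityIndex W₁ p ≠ 2) (hodd₁ : ¬ 2 ∣ (p - 1) / semistabilityIndex W₁ p)
    (hG₂ : TypeGOrd W₂ p) (hadd₂ : Addv W₂ p) (h2e₂ : 2 ∣ semistabilityIndex W₂ p)
    (he2₂ : semistabilityIndex W₂ p ≠ 2) (hodd₂ : ¬ 2 ∣ (p - 1) / semistabilityIndex W₂ p)
    (htors₁ : ¬ p ∣ W₁.torsionOrder) (htors₂ : ¬ p ∣ W₂.torsionOrder)
    (hRD₁ : RamifiedLineKummerEqAt W₁ p) (hRD₂ : RamifiedLineKummerEqAt W₂ p) (hT : TorsionIso W₁ W₂ p)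
    (S₀ : Finset (HeightOneSpectrum (𝓞 ℚ))) (hS₀ : ∀ w ∈ S₀, ((p : ℕ) : 𝓞 ℚ) ∉ w.asIdeal)
    (hS₁ : ∀ w : HeightOneSpectrum (𝓞 ℚ), w ∉ S₀ → ((p : ℕ) : 𝓞 ℚ) ∉ w.asIdeal →
      W₁.HasGoodReductionAt w)
    (hS₂ : ∀ w : HeightOneSpectrum (𝓞 ℚ), w ∉ S₀ → ((p : ℕ) : 𝓞 ℚ) ∉ w.asIdeal →
      W₂.HasGoodReductionAt w)
    {κ : ZpExtension ℚ p} {γ : absoluteGaloisGroup ℚ} (hκ : κ.IsCyclotomic)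
    (hγ : κ.IsTopGenerator γ) (hγ' : IsCyclotomicVariable p γ)
    (D₁ : W₁.SelmerDualData κ γ) (D₂ : W₂.SelmerDualData κ γ)
    [Module.Finite (IwasawaAlgebra p) D₁.X] [Module.Finite (IwasawaAlgebra p) D₂.X]
    (hX₁ : D₁.IsTorsion) (hX₂ : D₂.IsTorsion) (hμ₁ : D₁.mu = 0) : D₂.mu = 0 := by
  obtain ⟨v, hv⟩ := exists_natCast_mem_asIdeal (p := p)
  obtain ⟨L₁, hL₁, -⟩ := exists_isRamifiedOrdinaryLine_and_pow_semistabilityIndex_of_typeGOrd hp5 hG₁ hadd₁ hv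
  obtain ⟨L₂, hL₂, -⟩ := exists_isRamifiedOrdinaryLine_and_pow_semistabilityIndex_of_typeGOrd hp5 hG₂ hadd₂ hv
  obtain ⟨e, he⟩ := hT
  exact mu_eq_zero_of_gv W₁ W₂ p S₀ hGV (by omega) hv hL₁ hL₂ htors₁ htors₂ hRD₁ hRD₂
    ⟨e, he, inclusion_mem_iff_of_typeGOrd_of_even hp5 hG₁ hadd₁ h2e₁ he2₁ hodd₁ hG₂ hadd₂ h2e₂ he2₂ hodd₂
      hv hL₁ hL₂ e (fun σ _ P ↦ he _ P)⟩ hS₀ hS₁ hS₂ hκ hγ hγ' D₁ D₂ hX₁ hX₂ hμ₁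

/-! ### §3 Every per-curve binder from records: `hRD_i` mod S2 (p05 K5) -/

/-- **`CongruentLambdaShift` on a line-even Gord × Gord link, EVERY per-curve binder from records**
(`hGV` = A240 of records, `hS2` = S2; `TypeGOrd ∧ Addv`, the parity bits, the torsion bits, a
`TorsionIso` certificate and `Σ₀`).
[cite: GreenbergVatsal2000, §2 Prop. (2.8) with Remark (2.9), Cor. (2.3), Prop. (2.4), pp. 26–27 (arXiv:math/9906215)]
[cite: GreenbergLNM1716, §2 Prop. 2.4 (p. 80)] -/
theorem congruentLambdaShift_of_gv_of_s2_of_typeGOrd_typeGOrd_of_even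
    (hGV : muLambdaAlg_transfer_of_torsionIso_potOrd_of_not_dvd_torsionOrder)
    (hS2 : imKummer_ge_strictCondition_goodOrdinaryModel) (hp5 : 5 ≤ p)
    (hG₁ : TypeGOrd W₁ p) (hadd₁ : Addv W₁ p) (h2e₁ : 2 ∣ semistabilityIndex W₁ p)
    (he2₁ : semistabilityIndex W₁ p ≠ 2) (hodd₁ : ¬ 2 ∣ (p - 1) / semistabilityIndex W₁ p)
    (hG₂ : TypeGOrd W₂ p) (hadd₂ : Addv W₂ p) (h2e₂ : 2 ∣ semistabilityIndex W₂ p)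
    (he2₂ : semistabilityIndex W₂ p ≠ 2) (hodd₂ : ¬ 2 ∣ (p - 1) / semistabilityIndex W₂ p)
    (htors₁ : ¬ p ∣ W₁.torsionOrder) (htors₂ : ¬ p ∣ W₂.torsionOrder) (hT : TorsionIso W₁ W₂ p)
    (S₀ : Finset (HeightOneSpectrum (𝓞 ℚ))) (hS₀ : ∀ w ∈ S₀, ((p : ℕ) : 𝓞 ℚ) ∉ w.asIdeal)
    (hS₁ : ∀ w : HeightOneSpectrum (𝓞 ℚ), w ∉ S₀ → ((p : ℕ) : 𝓞 ℚ) ∉ w.asIdeal →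
      W₁.HasGoodReductionAt w)
    (hS₂ : ∀ w : HeightOneSpectrum (𝓞 ℚ), w ∉ S₀ → ((p : ℕ) : 𝓞 ℚ) ∉ w.asIdeal →
      W₂.HasGoodReductionAt w) :
    CongruentLambdaShift W₁ W₂ p (∑ w ∈ S₀, ((delta W₂ p w : ℤ) - (delta W₁ p w : ℤ))) :=
  congruentLambdaShift_of_gv_of_typeGOrd_typeGOrd_of_even hGV hp5 hG₁ hadd₁ h2e₁ he2₁ hodd₁ hG₂ hadd₂ h2e₂
    he2₂ hodd₂ htors₁ htors₂ (ramifiedLineKummerEqAt_of_s2_of_typeGOrd hS2 hp5 hG₁ hadd₁)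
    (ramifiedLineKummerEqAt_of_s2_of_typeGOrd hS2 hp5 hG₂ hadd₂) hT S₀ hS₀ hS₁ hS₂

/-- **`μ(X(E₁)) = 0 ⟹ μ(X(E₂)) = 0` on a line-even Gord × Gord link, every per-curve binder from
records.** [cite: GreenbergVatsal2000, §2 Prop. (2.8) with Remark (2.9), Cor. (2.3), pp. 26–27 (arXiv:math/9906215)]
[cite: GreenbergLNM1716, §2 Prop. 2.4 (p. 80)] -/
theorem mu_eq_zero_of_gv_of_s2_of_typeGOrd_typeGOrd_of_even
    (hGV : muLambdaAlg_transfer_of_torsionIso_potOrd_of_not_dvd_torsionOrder)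
    (hS2 : imKummer_ge_strictCondition_goodOrdinaryModel) (hp5 : 5 ≤ p)
    (hG₁ : TypeGOrd W₁ p) (hadd₁ : Addv W₁ p) (h2e₁ : 2 ∣ semistabilityIndex W₁ p)
    (he2₁ : semistabilityIndex W₁ p ≠ 2) (hodd₁ : ¬ 2 ∣ (p - 1) / semistabilityIndex W₁ p)
    (hG₂ : TypeGOrd W₂ p) (hadd₂ : Addv W₂ p) (h2e₂ : 2 ∣ semistabilityIndex W₂ p)
    (he2₂ : semistabilityIndex W₂ p ≠ 2) (hodd₂ : ¬ 2 ∣ (p - 1) / semistabilityIndex W₂ p)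
    (htors₁ : ¬ p ∣ W₁.torsionOrder) (htors₂ : ¬ p ∣ W₂.torsionOrder) (hT : TorsionIso W₁ W₂ p)
    (S₀ : Finset (HeightOneSpectrum (𝓞 ℚ))) (hS₀ : ∀ w ∈ S₀, ((p : ℕ) : 𝓞 ℚ) ∉ w.asIdeal)
    (hS₁ : ∀ w : HeightOneSpectrum (𝓞 ℚ), w ∉ S₀ → ((p : ℕ) : 𝓞 ℚ) ∉ w.asIdeal →
      W₁.HasGoodReductionAt w)
    (hS₂ : ∀ w : HeightOneSpectrum (𝓞 ℚ), w ∉ S₀ → ((p : ℕ) : 𝓞 ℚ) ∉ w.asIdeal →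
      W₂.HasGoodReductionAt w)
    {κ : ZpExtension ℚ p} {γ : absoluteGaloisGroup ℚ} (hκ : κ.IsCyclotomic)
    (hγ : κ.IsTopGenerator γ) (hγ' : IsCyclotomicVariable p γ)
    (D₁ : W₁.SelmerDualData κ γ) (D₂ : W₂.SelmerDualData κ γ)
    [Module.Finite (IwasawaAlgebra p) D₁.X] [Module.Finite (IwasawaAlgebra p) D₂.X]
    (hX₁ : D₁.IsTorsion) (hX₂ : D₂.IsTorsion) (hμ₁ : D₁.mu = 0) : D₂.mu = 0 :=
  mu_eq_zero_of_gv_of_typeGOrd_typeGOrd_of_even hGV hp5 hG₁ hadd₁ h2e₁ he2₁ hodd₁ hG₂ hadd₂ h2e₂ he2₂ hodd₂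
    htors₁ htors₂ (ramifiedLineKummerEqAt_of_s2_of_typeGOrd hS2 hp5 hG₁ hadd₁)
    (ramifiedLineKummerEqAt_of_s2_of_typeGOrd hS2 hp5 hG₂ hadd₂) hT S₀ hS₀ hS₁ hS₂ hκ hγ hγ' D₁ D₂ hX₁ hX₂
    hμ₁

end Shift

end GordEvenCongruentPairGV

open GordEvenCongruentPairGV

variable {p : ℕ} [hp : Fact p.Prime] {W₁ W₂ : WeierstrassCurve ℚ} [W₁.IsElliptic] [W₁.IsGloballyMinimal]
  [W₂.IsElliptic] [W₂.IsGloballyMinimal]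

/-- **X4♯(G-ord) × X4♯(G-ord) on the equal-parity swap locus ((5;4,4), (7;6,6)): `CongruentLambdaShift`
from the GV record + S2 + `TorsionIso` + `Σ₀` — NO line, NO R-D, NO image binder** (torsion bits by
irreducibility). X4♯(G-ord) stays CONSTRUCTION-SHAPED; nothing booked; NOT a budget node.
[cite: GreenbergVatsal2000, §2 Prop. (2.8) with Remark (2.9), Cor. (2.3), Prop. (2.4), pp. 26–27 (arXiv:math/9906215)]
[cite: GreenbergLNM1716, §2 Prop. 2.4 (p. 80)] [cite: Mazur1977, Ch. III §5, p. 157] -/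
theorem ClassX4Gord.congruentLambdaShift_of_gv_of_s2_of_even
    (hGV : muLambdaAlg_transfer_of_torsionIso_potOrd_of_not_dvd_torsionOrder)
    (hS2 : imKummer_ge_strictCondition_goodOrdinaryModel) (hp5 : 5 ≤ p)
    (hX₁ : ClassX4Gord W₁ p) (hX₂ : ClassX4Gord W₂ p)
    (h2e₁ : 2 ∣ semistabilityIndex W₁ p) (he2₁ : semistabilityIndex W₁ p ≠ 2)
    (hodd₁ : ¬ 2 ∣ (p - 1) / semistabilityIndex W₁ p)
    (h2e₂ : 2 ∣ semistabilityIndex W₂ p) (he2₂ : semistabilityIndex W₂ p ≠ 2)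
    (hodd₂ : ¬ 2 ∣ (p - 1) / semistabilityIndex W₂ p) (hT : TorsionIso W₁ W₂ p)
    (S₀ : Finset (HeightOneSpectrum (𝓞 ℚ))) (hS₀ : ∀ w ∈ S₀, ((p : ℕ) : 𝓞 ℚ) ∉ w.asIdeal)
    (hS₁ : ∀ w : HeightOneSpectrum (𝓞 ℚ), w ∉ S₀ → ((p : ℕ) : 𝓞 ℚ) ∉ w.asIdeal →
      W₁.HasGoodReductionAt w)
    (hS₂ : ∀ w : HeightOneSpectrum (𝓞 ℚ), w ∉ S₀ → ((p : ℕ) : 𝓞 ℚ) ∉ w.asIdeal →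
      W₂.HasGoodReductionAt w) :
    CongruentLambdaShift W₁ W₂ p (∑ w ∈ S₀, ((delta W₂ p w : ℤ) - (delta W₁ p w : ℤ))) :=
  congruentLambdaShift_of_gv_of_s2_of_typeGOrd_typeGOrd_of_even hGV hS2 hp5 hX₁.typeGOrd hX₁.addv.2 h2e₁
    he2₁ hodd₁ hX₂.typeGOrd hX₂.addv.2 h2e₂ he2₂ hodd₂ hX₁.not_dvd_torsionOrder hX₂.not_dvd_torsionOrder hT
    S₀ hS₀ hS₁ hS₂

/-- **X4♯(G-ord) × X4♯(G-ord) on the equal-parity swap locus: `μ(X(E₁)) = 0 ⟹ μ(X(E₂)) = 0`** from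
the GV record + S2 + `TorsionIso` + `Σ₀`. Nothing booked; NOT a budget node.
[cite: GreenbergVatsal2000, §2 Prop. (2.8) with Remark (2.9), Cor. (2.3), pp. 26–27 (arXiv:math/9906215)] -/
theorem ClassX4Gord.mu_eq_zero_of_gv_of_s2_of_even
    (hGV : muLambdaAlg_transfer_of_torsionIso_potOrd_of_not_dvd_torsionOrder)
    (hS2 : imKummer_ge_strictCondition_goodOrdinaryModel) (hp5 : 5 ≤ p)
    (hX₁ : ClassX4Gord W₁ p) (hX₂ : ClassX4Gord W₂ p)
    (h2e₁ : 2 ∣ semistabilityIndex W₁ p) (he2₁ : semistabilityIndex W₁ p ≠ 2)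
    (hodd₁ : ¬ 2 ∣ (p - 1) / semistabilityIndex W₁ p)
    (h2e₂ : 2 ∣ semistabilityIndex W₂ p) (he2₂ : semistabilityIndex W₂ p ≠ 2)
    (hodd₂ : ¬ 2 ∣ (p - 1) / semistabilityIndex W₂ p) (hT : TorsionIso W₁ W₂ p)
    (S₀ : Finset (HeightOneSpectrum (𝓞 ℚ))) (hS₀ : ∀ w ∈ S₀, ((p : ℕ) : 𝓞 ℚ) ∉ w.asIdeal)
    (hS₁ : ∀ w : HeightOneSpectrum (𝓞 ℚ), w ∉ S₀ → ((p : ℕ) : 𝓞 ℚ) ∉ w.asIdeal →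
      W₁.HasGoodReductionAt w)
    (hS₂ : ∀ w : HeightOneSpectrum (𝓞 ℚ), w ∉ S₀ → ((p : ℕ) : 𝓞 ℚ) ∉ w.asIdeal →
      W₂.HasGoodReductionAt w)
    {κ : ZpExtension ℚ p} {γ : absoluteGaloisGroup ℚ} (hκ : κ.IsCyclotomic)
    (hγ : κ.IsTopGenerator γ) (hγ' : IsCyclotomicVariable p γ)
    (D₁ : W₁.SelmerDualData κ γ) (D₂ : W₂.SelmerDualData κ γ)
    [Module.Finite (IwasawaAlgebra p) D₁.X] [Module.Finite (IwasawaAlgebra p) D₂.X]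
    (hX₁t : D₁.IsTorsion) (hX₂t : D₂.IsTorsion) (hμ₁ : D₁.mu = 0) : D₂.mu = 0 :=
  mu_eq_zero_of_gv_of_s2_of_typeGOrd_typeGOrd_of_even hGV hS2 hp5 hX₁.typeGOrd hX₁.addv.2 h2e₁ he2₁ hodd₁
    hX₂.typeGOrd hX₂.addv.2 h2e₂ he2₂ hodd₂ hX₁.not_dvd_torsionOrder hX₂.not_dvd_torsionOrder hT S₀ hS₀ hS₁
    hS₂ hκ hγ hγ' D₁ D₂ hX₁t hX₂t hμ₁

/-- **X3♯(G-ord) × X3♯(G-ord) on the equal-parity swap locus: `CongruentLambdaShift`** from the GV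
record + S2 + `TorsionIso` + `Σ₀` + ONE census bit `p ∤ #E₁(ℚ)_tors` (the partner's follows:
`not_dvd_torsionOrder_of_torsionIso`). X3♯(G-ord) stays CONSTRUCTION-SHAPED; nothing booked.
[cite: GreenbergVatsal2000, §2 Prop. (2.8) with Remark (2.9), Cor. (2.3), Prop. (2.4), pp. 26–27 (arXiv:math/9906215)]
[cite: GreenbergLNM1716, §2 Prop. 2.4 and Prop. 4.14] -/
theorem ClassX3Gord.congruentLambdaShift_of_gv_of_s2_of_even
    (hGV : muLambdaAlg_transfer_of_torsionIso_potOrd_of_not_dvd_torsionOrder)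
    (hS2 : imKummer_ge_strictCondition_goodOrdinaryModel) (hp5 : 5 ≤ p)
    (hX₁ : ClassX3Gord W₁ p) (hX₂ : ClassX3Gord W₂ p)
    (h2e₁ : 2 ∣ semistabilityIndex W₁ p) (he2₁ : semistabilityIndex W₁ p ≠ 2)
    (hodd₁ : ¬ 2 ∣ (p - 1) / semistabilityIndex W₁ p)
    (h2e₂ : 2 ∣ semistabilityIndex W₂ p) (he2₂ : semistabilityIndex W₂ p ≠ 2)
    (hodd₂ : ¬ 2 ∣ (p - 1) / semistabilityIndex W₂ p)
    (htors₁ : ¬ p ∣ W₁.torsionOrder) (hT : TorsionIso W₁ W₂ p)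
    (S₀ : Finset (HeightOneSpectrum (𝓞 ℚ))) (hS₀ : ∀ w ∈ S₀, ((p : ℕ) : 𝓞 ℚ) ∉ w.asIdeal)
    (hS₁ : ∀ w : HeightOneSpectrum (𝓞 ℚ), w ∉ S₀ → ((p : ℕ) : 𝓞 ℚ) ∉ w.asIdeal →
      W₁.HasGoodReductionAt w)
    (hS₂ : ∀ w : HeightOneSpectrum (𝓞 ℚ), w ∉ S₀ → ((p : ℕ) : 𝓞 ℚ) ∉ w.asIdeal →
      W₂.HasGoodReductionAt w) :
    CongruentLambdaShift W₁ W₂ p (∑ w ∈ S₀, ((delta W₂ p w : ℤ) - (delta W₁ p w : ℤ))) :=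
  congruentLambdaShift_of_gv_of_s2_of_typeGOrd_typeGOrd_of_even hGV hS2 hp5 hX₁.typeGOrd hX₁.addv h2e₁
    he2₁ hodd₁ hX₂.typeGOrd hX₂.addv h2e₂ he2₂ hodd₂ htors₁ (not_dvd_torsionOrder_of_torsionIso hT htors₁) hT
    S₀ hS₀ hS₁ hS₂

/-- **X3♯(G-ord) × X3♯(G-ord) on the equal-parity swap locus: `μ(X(E₁)) = 0 ⟹ μ(X(E₂)) = 0`** from the
GV record + S2 + `TorsionIso` + `Σ₀` + one census torsion bit. Nothing booked.
[cite: GreenbergVatsal2000, §2 Prop. (2.8) with Remark (2.9), Cor. (2.3), pp. 26–27 (arXiv:math/9906215)] -/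
theorem ClassX3Gord.mu_eq_zero_of_gv_of_s2_of_even
    (hGV : muLambdaAlg_transfer_of_torsionIso_potOrd_of_not_dvd_torsionOrder)
    (hS2 : imKummer_ge_strictCondition_goodOrdinaryModel) (hp5 : 5 ≤ p)
    (hX₁ : ClassX3Gord W₁ p) (hX₂ : ClassX3Gord W₂ p)
    (h2e₁ : 2 ∣ semistabilityIndex W₁ p) (he2₁ : semistabilityIndex W₁ p ≠ 2)
    (hodd₁ : ¬ 2 ∣ (p - 1) / semistabilityIndex W₁ p)
    (h2e₂ : 2 ∣ semistabilityIndex W₂ p) (he2₂ : semistabilityIndex W₂ p ≠ 2)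
    (hodd₂ : ¬ 2 ∣ (p - 1) / semistabilityIndex W₂ p)
    (htors₁ : ¬ p ∣ W₁.torsionOrder) (hT : TorsionIso W₁ W₂ p)
    (S₀ : Finset (HeightOneSpectrum (𝓞 ℚ))) (hS₀ : ∀ w ∈ S₀, ((p : ℕ) : 𝓞 ℚ) ∉ w.asIdeal)
    (hS₁ : ∀ w : HeightOneSpectrum (𝓞 ℚ), w ∉ S₀ → ((p : ℕ) : 𝓞 ℚ) ∉ w.asIdeal →
      W₁.HasGoodReductionAt w)
    (hS₂ : ∀ w : HeightOneSpectrum (𝓞 ℚ), w ∉ S₀ → ((p : ℕ) : 𝓞 ℚ) ∉ w.asIdeal →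
      W₂.HasGoodReductionAt w)
    {κ : ZpExtension ℚ p} {γ : absoluteGaloisGroup ℚ} (hκ : κ.IsCyclotomic)
    (hγ : κ.IsTopGenerator γ) (hγ' : IsCyclotomicVariable p γ)
    (D₁ : W₁.SelmerDualData κ γ) (D₂ : W₂.SelmerDualData κ γ)
    [Module.Finite (IwasawaAlgebra p) D₁.X] [Module.Finite (IwasawaAlgebra p) D₂.X]
    (hX₁t : D₁.IsTorsion) (hX₂t : D₂.IsTorsion) (hμ₁ : D₁.mu = 0) : D₂.mu = 0 :=
  mu_eq_zero_of_gv_of_s2_of_typeGOrd_typeGOrd_of_even hGV hS2 hp5 hX₁.typeGOrd hX₁.addv h2e₁ he2₁ hodd₁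
    hX₂.typeGOrd hX₂.addv h2e₂ he2₂ hodd₂ htors₁ (not_dvd_torsionOrder_of_torsionIso hT htors₁) hT S₀ hS₀ hS₁
    hS₂ hκ hγ hγ' D₁ D₂ hX₁t hX₂t hμ₁

end Summit.BirchSwinnertonDyer.Rank1Residual.Additive

end
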